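import Mathlib
import Summits.NavierStokesRegularity.NavierStokesRegularity.Theses.EulerMelnikovDss
import Summits.NavierStokesRegularity.NavierStokesRegularity.Theorems.FilamentSkeletonRssRdssProfileTruncation
import HarnessLib

/-!
# `EulerMelnikovDss.RotatedDssBlowupBridge` — the rotated truncation bridge
  (item stmt-NavierStokesRegularity-10475)

**Statement.** If for some factor `c` and some linear isometry `R` of `ℝ³` the rotated Type-I
`c`-DSS Liouville statement `Literature.Analysis.FluidPDE.RotatedTypeIDSSLiouville c R` FAILS, then
for some `ν > 0`, `T > 0` there is a Leray–Hopf classical Navier–Stokes solution from a rapidly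
decaying datum with finite maximal lifespan `T` (`IsMaximalSmoothSolution ∧ IsLerayHopfOn ∧
HasRapidSpatialDecay (u 0)`).

PROOF. Unfolding `¬ RotatedTypeIDSSLiouville c R` (`1 < c → ∀ u, ancient mild → measurable slices →
IsRotatedDSS c R u → Type-I decay → a.e. trivial`) produces `1 < c` and an ancient mild `u` with
measurable slices, rotated `c`-DSS, Type-I bounded and not a.e. trivial — verbatim the hypothesis
of the ACCEPTED sibling theorem `filamentSkeletonRss_rdssProfileTruncation_proof`
(`Theses.FilamentSkeletonRss.RdssProfileTruncation`, stmt-NavierStokesRegularity-11289), whose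
conclusion is verbatim the conclusion of this item. (The route docstring records this three-line
equivalence; the sibling `DssFarFieldSlaving.DssTruncationBridge`, stmt-14477, was closed the same
way in `Theorems/DssFarFieldSlavingDssTruncationBridge.lean`.)

HONEST FRAMING: a bookkeeping corollary of an accepted tree theorem about HYPOTHETICAL objects
(nontrivial Type-I rotated-DSS ancient profiles, whose existence is open); nothing here bears on the
regularity problem itself.
-/

noncomputable section

set_option linter.dupNamespace false

namespace Summit.NavierStokesRegularity.NavierStokesRegularity.Theorems

open MeasureTheory Literature.Analysis.FluidPDE

/-- **Item stmt-NavierStokesRegularity-10475** (`EulerMelnikovDss.RotatedDssBlowupBridge`): failure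
of some rotated Type-I `c`-DSS Liouville statement yields a Leray–Hopf classical solution from a
rapidly decaying datum with finite maximal lifespan — by unfolding the negated Liouville statement
into a nontrivial Type-I rotated-DSS ancient mild profile and applying the accepted
`filamentSkeletonRss_rdssProfileTruncation_proof`. [cite: BradshawTsai2017CPDE, §5 Open Problem 5.1] -/
theorem rotatedDssBlowupBridge_proof :
    Summit.NavierStokesRegularity.NavierStokesRegularity.Theses.EulerMelnikovDss.RotatedDssBlowupBridge := by
  unfold Summit.NavierStokesRegularity.NavierStokesRegularity.Theses.EulerMelnikovDss.RotatedDssBlowupBridge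
  rintro ⟨c, R, hnot⟩
  apply filamentSkeletonRss_rdssProfileTruncation_proof
  by_contra hno
  push Not at hno
  refine hnot fun hc u hu hmeas hdss hdec => ?_
  exact hno c R u hc hu hmeas hdss hdec

end Summit.NavierStokesRegularity.NavierStokesRegularity.Theorems

end
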